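import Summits.Ventures.HodgeRepro2.Sextic
import Summits.Ventures.HodgeRepro2.Reflex

/-!
# SexticGalois.lean — the `ℤ/6` census transported to every Galois CM field of degree 6

Seat p1 (gen 2) of the blind cell pub-hodge-repro2.  Sextic.lean part E proves the facts of TIER3
§5(i) in the `ℤ/6` MODEL; GaloisSextic.lean gives `Gal(K/ℚ) ≃* Multiplicative (ℤ/6)` for every
Galois CM field `K` of degree 6.  This file transports the model facts to such a field:

* `SexticCoordinates K`: a base embedding `τ₀` and an isomorphism `e : Multiplicative (ℤ/6) ≃* Gal(K/ℚ)`;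
  the embedding with coordinate `k` is `τ₀ ∘ e(k)` (`emb`), a set of coordinates `S` gives the set of
  embeddings `typeOf S`;
* `emb_add_three`: coordinate `k + 3` is the complex conjugate of coordinate `k`
  (`e(3)` is the unique element of order 2, i.e. complex conjugation);
* `inverseType_typeOf`: the inverse type is `zInv` (negation) in coordinates;
* `parityTetrahedron_eq_typeOf`: a parity tetrahedron is `zTypeOf k ∘ oddTetra` in coordinates;
* **`range_inverseType_parityTetrahedron`**: for every sextic Galois CM field, every base point
  `τ₀`, every CM type `τ : Fin 3 → (K →+* ℂ)`: inversion maps the parity tetrahedron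
  `{T_i}` onto ITSELF as a set of four CM types — TIER3 §5(i) "the tetrahedron `{T_i}` maps to the
  tetrahedron `{T_i⁻¹}`" (kernel-decided in the model over all 216 coordinate triples, then
  transported).
-/

namespace Summit.Ventures.HodgeRepro2

open NumberField

/-! ## The model statement -/

/-- The coordinate types of the cube vertex `s` relative to the coordinate triple `k`
(`zType` of Sextic.lean with `k = (0, 1, 2)`). -/
def zTypeOf (k : Fin 3 → ZMod 6) (s : CubeVertex) : Finset (ZMod 6) :=
  Finset.univ.image fun ν : Fin 3 => if s ν then k ν else k ν + 3

/-- The model statement, decided in the kernel over all 216 coordinate triples: if `k` picks one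
member of each pair, negation maps the four types of the odd tetrahedron onto the same four
types. -/
theorem zInv_zTypeOf_oddTetra : ∀ k : Fin 3 → ZMod 6,
    (∀ m : ZMod 6, Xor (m ∈ Finset.univ.image k) (m + 3 ∈ Finset.univ.image k)) →
      Finset.univ.image (fun i => zInv (zTypeOf k (oddTetra i))) =
        Finset.univ.image (fun i => zTypeOf k (oddTetra i)) := by
  decide +kernel

/-- The model statement for primitivity, decided in the kernel: for every admissible coordinate
triple `k`, exactly one vertex of the odd tetrahedron is non-primitive. -/
theorem card_nonPrimitive_zTypeOf_oddTetra : ∀ k : Fin 3 → ZMod 6,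
    (∀ m : ZMod 6, Xor (m ∈ Finset.univ.image k) (m + 3 ∈ Finset.univ.image k)) →
      (Finset.univ.filter fun i => ¬ IsZPrimitive (zTypeOf k (oddTetra i))).card = 1 := by
  decide +kernel

/-! ## Coordinates on a Galois CM field of degree 6 -/

section Coordinates

variable (K : Type*) [Field K] [NumberField K] [IsGalois ℚ K]

/-- A coordinate system on the embeddings of a Galois CM field of degree 6: a base embedding and an
isomorphism of `Gal(K/ℚ)` with `ℤ/6` (exists by `nonempty_mulEquiv_zmod_six`). -/
structure SexticCoordinates where
  /-- the base embedding (coordinate `0`) -/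
  τ₀ : K →+* ℂ
  /-- the identification of the Galois group with `ℤ/6` -/
  e : Multiplicative (ZMod 6) ≃* (K ≃ₐ[ℚ] K)

variable {K}

/-- The embedding with coordinate `k`: `τ₀ ∘ e(k)`. -/
noncomputable def SexticCoordinates.emb (c : SexticCoordinates K) (k : ZMod 6) : K →+* ℂ :=
  galEmb K c.τ₀ (c.e (Multiplicative.ofAdd k))

/-- The set of embeddings with coordinates in `S`. -/
def SexticCoordinates.typeOf (c : SexticCoordinates K) (S : Finset (ZMod 6)) : Set (K →+* ℂ) :=
  c.emb '' (S : Set (ZMod 6))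

/-- `emb` is a bijection `ℤ/6 → (K →+* ℂ)`. -/
theorem SexticCoordinates.emb_bijective (c : SexticCoordinates K) : Function.Bijective c.emb :=
  (galEmb K c.τ₀).bijective.comp (c.e.bijective.comp (Multiplicative.ofAdd.bijective))

/-- `typeOf` is injective. -/
theorem SexticCoordinates.typeOf_injective (c : SexticCoordinates K) :
    Function.Injective c.typeOf := by
  intro S S' h
  exact Finset.coe_injective (Set.image_injective.mpr c.emb_bijective.injective h)

/-- The inverse type is negation in coordinates. -/
theorem SexticCoordinates.inverseType_typeOf (c : SexticCoordinates K) (S : Finset (ZMod 6)) :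
    inverseType K c.τ₀ (c.typeOf S) = c.typeOf (zInv S) := by
  ext φ
  obtain ⟨k, rfl⟩ := c.emb_bijective.surjective φ
  have hk : c.emb k = galEmb K c.τ₀ (c.e (Multiplicative.ofAdd k)) := rfl
  rw [hk, mem_inverseType_iff, ← map_inv, ← ofAdd_neg]
  change galEmb K c.τ₀ (c.e (Multiplicative.ofAdd (-k))) ∈ c.typeOf S ↔ c.emb k ∈ c.typeOf (zInv S)
  have hmem : ∀ (m : ZMod 6) (T : Finset (ZMod 6)), c.emb m ∈ c.typeOf T ↔ m ∈ T := fun m T => by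
    constructor
    · rintro ⟨x, hx, hxm⟩
      rw [c.emb_bijective.injective hxm] at hx
      exact hx
    · intro hm
      exact ⟨m, hm, rfl⟩
  change c.emb (-k) ∈ c.typeOf S ↔ c.emb k ∈ c.typeOf (zInv S)
  rw [hmem, hmem, zInv, Finset.mem_image]
  constructor
  · intro h
    exact ⟨-k, h, neg_neg k⟩
  · rintro ⟨m, hm, hmk⟩
    rw [← hmk, neg_neg]
    exact hm

/-- Membership in `typeOf`. -/
theorem SexticCoordinates.emb_mem_typeOf_iff (c : SexticCoordinates K) (m : ZMod 6)
    (T : Finset (ZMod 6)) : c.emb m ∈ c.typeOf T ↔ m ∈ T := by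
  constructor
  · rintro ⟨x, hx, hxm⟩
    rw [c.emb_bijective.injective hxm] at hx
    exact hx
  · intro hm
    exact ⟨m, hm, rfl⟩

/-- `Set.range` of `typeOf ∘ A` is the image of the `Finset` of values. -/
theorem SexticCoordinates.range_typeOf (c : SexticCoordinates K) (A : Fin 4 → Finset (ZMod 6)) :
    Set.range (fun i => c.typeOf (A i)) =
      c.typeOf '' (↑(Finset.univ.image A) : Set (Finset (ZMod 6))) := by
  rw [Finset.coe_image, Finset.coe_univ, Set.image_univ, ← Set.range_comp]
  rfl

/-- The Galois-group set of a coordinate type: the preimage of `typeOf S` under `galEmb τ₀` is the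
image of `S` under `k ↦ e(k)`. -/
theorem SexticCoordinates.preimage_typeOf (c : SexticCoordinates K) (S : Finset (ZMod 6)) :
    (galEmb K c.τ₀) ⁻¹' (c.typeOf S) =
      (fun k : ZMod 6 => c.e (Multiplicative.ofAdd k)) '' (S : Set (ZMod 6)) := by
  ext σ
  obtain ⟨k, rfl⟩ := (c.e.toEquiv.trans (Equiv.refl _)).surjective σ
  obtain ⟨m, rfl⟩ := Multiplicative.ofAdd.surjective k
  simp only [Set.mem_preimage, MulEquiv.toEquiv_eq_coe, Equiv.trans_refl, EquivLike.coe_coe]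
  have h1 : galEmb K c.τ₀ (c.e (Multiplicative.ofAdd m)) ∈ c.typeOf S ↔ m ∈ S :=
    c.emb_mem_typeOf_iff m S
  rw [h1]
  constructor
  · intro hm
    exact ⟨m, hm, rfl⟩
  · rintro ⟨m', hm', hmm⟩
    have : m' = m := Multiplicative.ofAdd.injective (c.e.injective hmm)
    rw [← this]
    exact hm'

/-- Primitivity of a coordinate type, read on `Gal(K/ℚ)`, is `IsZPrimitive` in coordinates. -/
theorem SexticCoordinates.isPrimitiveOn_preimage_typeOf_iff (c : SexticCoordinates K)
    (S : Finset (ZMod 6)) :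
    IsPrimitiveOn ((galEmb K c.τ₀) ⁻¹' (c.typeOf S)) ↔ IsZPrimitive S := by
  rw [c.preimage_typeOf]
  set f : ZMod 6 → (K ≃ₐ[ℚ] K) := fun k => c.e (Multiplicative.ofAdd k) with hf
  have hfinj : Function.Injective f := c.e.injective.comp Multiplicative.ofAdd.injective
  have hfsurj : Function.Surjective f := c.e.surjective.comp Multiplicative.ofAdd.surjective
  have hfmul : ∀ a b, f (a + b) = f a * f b := fun a b => by
    simp only [hf, ofAdd_add, map_mul]
  have hmem : ∀ (a : ZMod 6), f a ∈ f '' (S : Set (ZMod 6)) ↔ a ∈ S := fun a =>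
    ⟨fun ⟨b, hb, hba⟩ => hfinj hba ▸ hb, fun ha => ⟨a, ha, rfl⟩⟩
  constructor
  · intro h g hg
    -- `g + S = S` gives `f g` in the stabiliser, hence `f g = 1 = f 0`
    have : f g = 1 := by
      apply h (f g)
      intro x
      obtain ⟨b, rfl⟩ := hfsurj x
      rw [← hfmul, hmem, hmem]
      constructor
      · intro hb
        rw [← hg] at hb
        obtain ⟨b', hb', hbb⟩ := Finset.mem_image.mp hb
        rwa [← add_left_cancel hbb]
      · intro hb
        rw [← hg]
        exact Finset.mem_image.mpr ⟨b, hb, rfl⟩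
    have h0 : f 0 = 1 := by simp [hf]
    exact hfinj (this.trans h0.symm)
  · intro h g hg
    obtain ⟨a, rfl⟩ := hfsurj g
    have ha : a = 0 := by
      apply h a
      ext x
      rw [Finset.mem_image]
      constructor
      · rintro ⟨b, hb, rfl⟩
        have := hg (f b)
        rw [← hfmul, hmem, hmem] at this
        exact this.mpr hb
      · intro hx
        refine ⟨x - a, ?_, by ring⟩
        have := hg (f (x - a))
        rw [← hfmul, hmem, hmem] at this
        have hxa : a + (x - a) = x := by ring
        rw [hxa] at this
        exact this.mp hx
    rw [ha]
    simp [hf]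

variable [IsCMField K] (h6 : Module.finrank ℚ K = 6)
include h6

/-- Coordinate `3` is complex conjugation (the unique element of order 2 of `Gal(K/ℚ)`). -/
theorem SexticCoordinates.e_ofAdd_three (c : SexticCoordinates K) :
    c.e (Multiplicative.ofAdd 3) = galConj K := by
  apply eq_galConj_of_orderOf_eq_two K h6
  rw [c.e.orderOf_eq, orderOf_ofAdd_eq_addOrderOf]
  have : ((3 : ℕ) : ZMod 6) = 3 := by norm_num
  rw [← this, ZMod.addOrderOf_coe 3 (by norm_num)]
  norm_num

/-- Coordinate `k + 3` is the complex conjugate of coordinate `k`. -/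
theorem SexticCoordinates.emb_add_three (c : SexticCoordinates K) (k : ZMod 6) :
    c.emb (3 + k) = ComplexEmbedding.conjugate (c.emb k) := by
  unfold SexticCoordinates.emb
  rw [ofAdd_add, map_mul, c.e_ofAdd_three h6, galEmb_galConj_mul]

/-- A cube type relative to `τ = c.emb ∘ k` is `zTypeOf k` in coordinates. -/
theorem SexticCoordinates.cubeType_emb (c : SexticCoordinates K) (k : Fin 3 → ZMod 6)
    (s : CubeVertex) : cubeType (fun ν => c.emb (k ν)) s = c.typeOf (zTypeOf k s) := by
  unfold cubeType SexticCoordinates.typeOf zTypeOf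
  rw [Finset.coe_image, Finset.coe_univ, Set.image_univ, ← Set.range_comp]
  congr 1
  funext ν
  simp only [Function.comp]
  by_cases hs : s ν = true
  · rw [if_pos hs, if_pos hs]
  · rw [if_neg hs, if_neg hs, add_comm, c.emb_add_three h6]

/-- A parity tetrahedron is `zTypeOf k ∘ oddTetra` in coordinates. -/
theorem SexticCoordinates.parityTetrahedron_eq_typeOf (c : SexticCoordinates K)
    (k : Fin 3 → ZMod 6) :
    parityTetrahedron K (fun ν => c.emb (k ν)) = fun i => c.typeOf (zTypeOf k (oddTetra i)) := by
  rw [parityTetrahedron_eq_cubeType]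
  funext i
  exact c.cubeType_emb h6 k (oddTetra i)

/-- The range of a CM type `τ = c.emb ∘ k` is a CM type iff the coordinates `k` pick one member of
each pair `{m, m + 3}`. -/
theorem SexticCoordinates.isCMType_range_iff (c : SexticCoordinates K) (k : Fin 3 → ZMod 6) :
    IsCMType K (Set.range fun ν => c.emb (k ν)) ↔
      ∀ m : ZMod 6, Xor (m ∈ Finset.univ.image k) (m + 3 ∈ Finset.univ.image k) := by
  have hrange : (Set.range fun ν => c.emb (k ν)) = c.typeOf (Finset.univ.image k) := by
    unfold SexticCoordinates.typeOf
    rw [Finset.coe_image, Finset.coe_univ, Set.image_univ, ← Set.range_comp]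
    rfl
  rw [hrange]
  constructor
  · intro h m
    have := h (c.emb m)
    rwa [← c.emb_add_three h6, c.emb_mem_typeOf_iff, c.emb_mem_typeOf_iff, add_comm] at this
  · intro h φ
    obtain ⟨m, rfl⟩ := c.emb_bijective.surjective φ
    rw [← c.emb_add_three h6, c.emb_mem_typeOf_iff, c.emb_mem_typeOf_iff, add_comm]
    exact h m

/-- **Inversion maps a parity tetrahedron onto itself** (TIER3 §5(i)), for every Galois CM field of
degree 6, every coordinate system and every coordinate triple `k` whose embeddings form a CM
type. -/
theorem SexticCoordinates.range_inverseType_parityTetrahedron (c : SexticCoordinates K)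
    (k : Fin 3 → ZMod 6) (hk : IsCMType K (Set.range fun ν => c.emb (k ν))) :
    Set.range (fun i => inverseType K c.τ₀ (parityTetrahedron K (fun ν => c.emb (k ν)) i)) =
      Set.range (parityTetrahedron K (fun ν => c.emb (k ν))) := by
  rw [c.parityTetrahedron_eq_typeOf h6 k]
  have hk' := (c.isCMType_range_iff h6 k).mp hk
  have hmodel := zInv_zTypeOf_oddTetra k hk'
  have hfun : (fun i => inverseType K c.τ₀ ((fun i => c.typeOf (zTypeOf k (oddTetra i))) i)) =
      fun i => c.typeOf (zInv (zTypeOf k (oddTetra i))) := by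
    funext i
    exact c.inverseType_typeOf _
  rw [hfun, c.range_typeOf, c.range_typeOf, hmodel]

open Classical in
/-- **Exactly one vertex of a parity tetrahedron is non-primitive** (TIER3 §5(i)), in coordinates. -/
theorem SexticCoordinates.card_nonPrimitive_parityTetrahedron (c : SexticCoordinates K)
    (k : Fin 3 → ZMod 6) (hk : IsCMType K (Set.range fun ν => c.emb (k ν))) :
    (Finset.univ.filter fun i =>
      ¬ IsPrimitiveOn ((galEmb K c.τ₀) ⁻¹' (parityTetrahedron K (fun ν => c.emb (k ν)) i))).card
      = 1 := by
  rw [c.parityTetrahedron_eq_typeOf h6 k]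
  have hk' := (c.isCMType_range_iff h6 k).mp hk
  have hmodel := card_nonPrimitive_zTypeOf_oddTetra k hk'
  rw [← hmodel]
  congr 1
  ext i
  simp only [Finset.mem_filter, Finset.mem_univ, true_and, c.isPrimitiveOn_preimage_typeOf_iff]

end Coordinates

section Field

variable (K : Type*) [Field K] [NumberField K] [IsCMField K] [IsGalois ℚ K]
  (h6 : Module.finrank ℚ K = 6)
include h6

/-- Every injective CM type `τ : Fin 3 → (K →+* ℂ)` has coordinates in some coordinate system with
base point any prescribed `τ₀`. -/
theorem exists_sexticCoordinates (τ₀ : K →+* ℂ) (τ : Fin 3 → (K →+* ℂ)) :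
    ∃ (c : SexticCoordinates K) (k : Fin 3 → ZMod 6), c.τ₀ = τ₀ ∧ τ = fun ν => c.emb (k ν) := by
  obtain ⟨e⟩ := nonempty_mulEquiv_zmod_six K h6
  let c : SexticCoordinates K := ⟨τ₀, e⟩
  have hsurj := c.emb_bijective.surjective
  choose k hk using fun ν => hsurj (τ ν)
  exact ⟨c, k, rfl, funext fun ν => (hk ν).symm⟩

/-- **Field-level statement**: for every Galois CM field of degree 6, every base point `τ₀` and
every CM type `τ`, inversion relative to `τ₀` maps the parity tetrahedron of `τ` onto itself. -/
theorem range_inverseType_parityTetrahedron (τ₀ : K →+* ℂ) (τ : Fin 3 → (K →+* ℂ))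
    (hΦ : IsCMType K (Set.range τ)) :
    Set.range (fun i => inverseType K τ₀ (parityTetrahedron K τ i)) =
      Set.range (parityTetrahedron K τ) := by
  obtain ⟨c, k, hc, rfl⟩ := exists_sexticCoordinates K h6 τ₀ τ
  subst hc
  exact c.range_inverseType_parityTetrahedron h6 k hΦ

open Classical in
/-- **Field-level statement**: in every parity tetrahedron of a Galois CM field of degree 6 exactly
one vertex is non-primitive (its reflex field has degree 2 by
`finrank_reflexFieldOf_eq_two_of_not_isPrimitiveOn`; the other three have reflex field `K` by
`reflexFieldOf_eq_top_of_isPrimitiveOn`). -/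
theorem card_nonPrimitive_parityTetrahedron (τ₀ : K →+* ℂ) (τ : Fin 3 → (K →+* ℂ))
    (hΦ : IsCMType K (Set.range τ)) :
    (Finset.univ.filter fun i =>
      ¬ IsPrimitiveOn ((galEmb K τ₀) ⁻¹' (parityTetrahedron K τ i))).card = 1 := by
  obtain ⟨c, k, hc, rfl⟩ := exists_sexticCoordinates K h6 τ₀ τ
  subst hc
  exact c.card_nonPrimitive_parityTetrahedron h6 k hΦ

end Field

end Summit.Ventures.HodgeRepro2
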